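import Literature.AlgebraicGeometry.RelativeSpec.FiniteGroupQuotient
import HarnessLib

/-!
# Actions of a group on a fibre product (SGA 1, Exp. V §1; SGA 3, Exp. V §1)

Route-agnostic plumbing for the tree's action datum `RelativeSpec.ActionOver` («a homomorphism
`G → Aut X` whose elements commute with `r : X → Y`»). Given compatible actions of `G` on the three
corners of a cospan `X₁ → Z ← X₂` — homomorphisms `a₁ : G → Aut X₁`, `a₂ : G → Aut X₂`, `a_Z : G → Aut Z`
with `aᵢ(g) ≫ fᵢ = fᵢ ≫ a_Z(g)` — the group acts on the fibre product `X₁ ×_Z X₂` by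
`g ↦ a₁(g) ×_{a_Z(g)} a₂(g)` (Mathlib `pullback.map`):

* `ActionOver.pullbackMapAut` — the automorphism of `pullback f₁ f₂` induced by `g`;
* `ActionOver.pullbackMapHom` — the homomorphism `G →* Aut (pullback f₁ f₂)`, with
  `pullbackMapHom_hom_fst` / `pullbackMapHom_hom_snd` (it covers `a₁(g)`, `a₂(g)` along the two
  projections);
* `ActionOver.onPullback` — packaged as an `ActionOver r G` for any `G`-invariant `r` out of the fibre
  product, and the two standard packagings: `ActionOver.diagonal` (both factors `G`-schemes over an
  invariant base map `r₁ : X₁ → B`: the DIAGONAL action over `pr₁ ≫ r₁`, e.g. `A ×_M A` for an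
  equivariant abelian scheme `A` over a `G`-scheme `M`) and `ActionOver.baseChange` (trivial action on
  `X₂` and `Z`: the BASE-CHANGED action on `X₁ ×_Z X₂` over `X₂`, i.e. the datum `ρ′` with
  `ρ′(g) ≫ pr₁ = pr₁ ≫ ρ(g)` that ★ `isGeometricQuotient_baseChange_of_free` /
  `…_of_flat` / `…_of_isUnit_card` take as a hypothesis — `baseChange_aut_hom_fst` discharges it).

All `def`s are constructions with bodies (D-0026); the theorems are the projection formulas and the
group laws. Companion for `SchemeOver R` / `Over (Spec R)` whiskering: ★ `ActionOverBaseChange`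
(`ActionOver.tensorRight`). Consumers: the finite-quotient descent files ★
`GeometricQuotientFreeEquivariantDescent` / `GeometricQuotientFreeFibreProduct`, whose statements take
the action on a fibre product as a hypothesis.

Mathlib searched (pin): `pullback.map`, `pullback.map_comp`, `pullback.map_id`, `pullback.lift_fst`,
`pullback.lift_snd`, `pullback.hom_ext`, `CategoryTheory.Aut` (`Aut_mul_def`, `Aut_inv_def`),
`MonoidHom.mk'` (all used); Mathlib has no group actions on schemes over a base.

## References

* A. Grothendieck, *SGA 1*, Exp. V §1 (schémas à groupe fini d'opérateurs, changement de base). [SGA1]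
* D. Mumford, *Abelian Varieties* (1970), §7 (quotients by finite groups). [MumfordAV1970]
-/

noncomputable section

universe u

open CategoryTheory Limits AlgebraicGeometry

namespace Literature.AlgebraicGeometry.RelativeSpec.ActionOver

variable {X₁ X₂ Z : Scheme.{u}} (f₁ : X₁ ⟶ Z) (f₂ : X₂ ⟶ Z) {G : Type*} [Group G]
  (a₁ : G →* Aut X₁) (a₂ : G →* Aut X₂) (aZ : G →* Aut Z)
  (h₁ : ∀ g : G, (a₁ g).hom ≫ f₁ = f₁ ≫ (aZ g).hom) (h₂ : ∀ g : G, (a₂ g).hom ≫ f₂ = f₂ ≫ (aZ g).hom)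

/-! ### The action on a fibre product -/

/-- The endomorphism `a₁(g) ×_{a_Z(g)} a₂(g)` of `X₁ ×_Z X₂` induced by `g ∈ G` acting compatibly
on the three corners of the cospan (Mathlib `pullback.map`). [cite: SGA1, Exp. V §1] -/
def pullbackMapEnd (g : G) : pullback f₁ f₂ ⟶ pullback f₁ f₂ :=
  pullback.map f₁ f₂ f₁ f₂ (a₁ g).hom (a₂ g).hom (aZ g).hom (h₁ g).symm (h₂ g).symm

/-- `pullbackMapEnd g` covers `a₁(g)` along the first projection. [cite: SGA1, Exp. V §1] -/
@[simp] theorem pullbackMapEnd_fst (g : G) :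
    pullbackMapEnd f₁ f₂ a₁ a₂ aZ h₁ h₂ g ≫ pullback.fst f₁ f₂ = pullback.fst f₁ f₂ ≫ (a₁ g).hom :=
  pullback.lift_fst _ _ _

/-- `pullbackMapEnd g` covers `a₂(g)` along the second projection. [cite: SGA1, Exp. V §1] -/
@[simp] theorem pullbackMapEnd_snd (g : G) :
    pullbackMapEnd f₁ f₂ a₁ a₂ aZ h₁ h₂ g ≫ pullback.snd f₁ f₂ = pullback.snd f₁ f₂ ≫ (a₂ g).hom :=
  pullback.lift_snd _ _ _

/-- `pullbackMapEnd 1 = 𝟙`. [cite: SGA1, Exp. V §1] -/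
theorem pullbackMapEnd_one : pullbackMapEnd f₁ f₂ a₁ a₂ aZ h₁ h₂ 1 = 𝟙 _ := by
  apply pullback.hom_ext
  · rw [pullbackMapEnd_fst, map_one, Category.id_comp]; exact Category.comp_id _
  · rw [pullbackMapEnd_snd, map_one, Category.id_comp]; exact Category.comp_id _

/-- `pullbackMapEnd (g h) = pullbackMapEnd h ≫ pullbackMapEnd g` (Mathlib's `Aut` multiplies by
`g * h = h ≫ g`). [cite: SGA1, Exp. V §1] -/
theorem pullbackMapEnd_mul (g h : G) :
    pullbackMapEnd f₁ f₂ a₁ a₂ aZ h₁ h₂ (g * h) =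
      pullbackMapEnd f₁ f₂ a₁ a₂ aZ h₁ h₂ h ≫ pullbackMapEnd f₁ f₂ a₁ a₂ aZ h₁ h₂ g := by
  apply pullback.hom_ext
  · rw [pullbackMapEnd_fst, Category.assoc, pullbackMapEnd_fst, ← Category.assoc, pullbackMapEnd_fst,
      Category.assoc, map_mul, Aut.Aut_mul_def, Iso.trans_hom]
  · rw [pullbackMapEnd_snd, Category.assoc, pullbackMapEnd_snd, ← Category.assoc, pullbackMapEnd_snd,
      Category.assoc, map_mul, Aut.Aut_mul_def, Iso.trans_hom]

/-- **The automorphism of `X₁ ×_Z X₂` induced by `g`**: `a₁(g) ×_{a_Z(g)} a₂(g)` with inverse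
`a₁(g⁻¹) ×_{a_Z(g⁻¹)} a₂(g⁻¹)`. [cite: SGA1, Exp. V §1] -/
def pullbackMapAut (g : G) : Aut (pullback f₁ f₂) where
  hom := pullbackMapEnd f₁ f₂ a₁ a₂ aZ h₁ h₂ g
  inv := pullbackMapEnd f₁ f₂ a₁ a₂ aZ h₁ h₂ g⁻¹
  hom_inv_id := by rw [← pullbackMapEnd_mul, inv_mul_cancel, pullbackMapEnd_one]
  inv_hom_id := by rw [← pullbackMapEnd_mul, mul_inv_cancel, pullbackMapEnd_one]

/-- Unfolding `pullbackMapAut`. [cite: SGA1, Exp. V §1] -/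
@[simp] theorem pullbackMapAut_hom (g : G) :
    (pullbackMapAut f₁ f₂ a₁ a₂ aZ h₁ h₂ g).hom = pullbackMapEnd f₁ f₂ a₁ a₂ aZ h₁ h₂ g := rfl

/-- **The action of `G` on `X₁ ×_Z X₂`** as a homomorphism `G →* Aut (X₁ ×_Z X₂)`.
[cite: SGA1, Exp. V §1] -/
def pullbackMapHom : G →* Aut (pullback f₁ f₂) where
  toFun := pullbackMapAut f₁ f₂ a₁ a₂ aZ h₁ h₂
  map_one' := Iso.ext (pullbackMapEnd_one f₁ f₂ a₁ a₂ aZ h₁ h₂)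
  map_mul' g h := Iso.ext (by
    rw [pullbackMapAut_hom, Aut.Aut_mul_def, Iso.trans_hom, pullbackMapAut_hom, pullbackMapAut_hom]
    exact pullbackMapEnd_mul f₁ f₂ a₁ a₂ aZ h₁ h₂ g h)

/-- `ρ(g) ≫ pr₁ = pr₁ ≫ a₁(g)` for the fibre-product action. [cite: SGA1, Exp. V §1] -/
@[simp] theorem pullbackMapHom_hom_fst (g : G) :
    (pullbackMapHom f₁ f₂ a₁ a₂ aZ h₁ h₂ g).hom ≫ pullback.fst f₁ f₂ =
      pullback.fst f₁ f₂ ≫ (a₁ g).hom :=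
  pullbackMapEnd_fst f₁ f₂ a₁ a₂ aZ h₁ h₂ g

/-- `ρ(g) ≫ pr₂ = pr₂ ≫ a₂(g)` for the fibre-product action. [cite: SGA1, Exp. V §1] -/
@[simp] theorem pullbackMapHom_hom_snd (g : G) :
    (pullbackMapHom f₁ f₂ a₁ a₂ aZ h₁ h₂ g).hom ≫ pullback.snd f₁ f₂ =
      pullback.snd f₁ f₂ ≫ (a₂ g).hom :=
  pullbackMapEnd_snd f₁ f₂ a₁ a₂ aZ h₁ h₂ g

/-! ### Packagings as `ActionOver` -/

/-- **The fibre-product action over an invariant base map.** For any `r : X₁ ×_Z X₂ → B` invariant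
under the fibre-product action, the datum `ActionOver r G`. [cite: SGA1, Exp. V §1] -/
def onPullback {B : Scheme.{u}} (r : pullback f₁ f₂ ⟶ B)
    (hr : ∀ g : G, (pullbackMapHom f₁ f₂ a₁ a₂ aZ h₁ h₂ g).hom ≫ r = r) : ActionOver r G where
  aut := pullbackMapHom f₁ f₂ a₁ a₂ aZ h₁ h₂
  aut_comp := hr

/-- Unfolding `onPullback`. [cite: SGA1, Exp. V §1] -/
@[simp] theorem onPullback_aut {B : Scheme.{u}} (r : pullback f₁ f₂ ⟶ B)
    (hr : ∀ g : G, (pullbackMapHom f₁ f₂ a₁ a₂ aZ h₁ h₂ g).hom ≫ r = r) :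
    (onPullback f₁ f₂ a₁ a₂ aZ h₁ h₂ r hr).aut = pullbackMapHom f₁ f₂ a₁ a₂ aZ h₁ h₂ := rfl

/-- **The diagonal action.** If `G` acts on `X₁` over `r₁ : X₁ → B` (`ρ₁ : ActionOver r₁ G`), on `X₂`
by `a₂` and on `Z` by `a_Z`, compatibly with `f₁`, `f₂`, then `G` acts on `X₁ ×_Z X₂` over
`pr₁ ≫ r₁` — e.g. the diagonal action of `Γ` on `A ×_M A` over `M → M/Γ` for a `Γ`-equivariant
abelian scheme `A → M`. [cite: SGA1, Exp. V §1] -/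
def diagonal {B : Scheme.{u}} {r₁ : X₁ ⟶ B} (ρ₁ : ActionOver r₁ G)
    (h₁' : ∀ g : G, (ρ₁.aut g).hom ≫ f₁ = f₁ ≫ (aZ g).hom) :
    ActionOver (pullback.fst f₁ f₂ ≫ r₁) G :=
  onPullback f₁ f₂ ρ₁.aut a₂ aZ h₁' h₂ (pullback.fst f₁ f₂ ≫ r₁) fun g => by
    rw [← Category.assoc, pullbackMapHom_hom_fst, Category.assoc, ρ₁.aut_comp]

/-- The diagonal action covers `ρ₁(g)` along `pr₁`. [cite: SGA1, Exp. V §1] -/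
@[simp] theorem diagonal_aut_hom_fst {B : Scheme.{u}} {r₁ : X₁ ⟶ B} (ρ₁ : ActionOver r₁ G)
    (h₁' : ∀ g : G, (ρ₁.aut g).hom ≫ f₁ = f₁ ≫ (aZ g).hom) (g : G) :
    ((diagonal f₁ f₂ a₂ aZ h₂ ρ₁ h₁').aut g).hom ≫ pullback.fst f₁ f₂ =
      pullback.fst f₁ f₂ ≫ (ρ₁.aut g).hom :=
  pullbackMapHom_hom_fst f₁ f₂ ρ₁.aut a₂ aZ h₁' h₂ g

/-- The diagonal action covers `a₂(g)` along `pr₂`. [cite: SGA1, Exp. V §1] -/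
@[simp] theorem diagonal_aut_hom_snd {B : Scheme.{u}} {r₁ : X₁ ⟶ B} (ρ₁ : ActionOver r₁ G)
    (h₁' : ∀ g : G, (ρ₁.aut g).hom ≫ f₁ = f₁ ≫ (aZ g).hom) (g : G) :
    ((diagonal f₁ f₂ a₂ aZ h₂ ρ₁ h₁').aut g).hom ≫ pullback.snd f₁ f₂ =
      pullback.snd f₁ f₂ ≫ (a₂ g).hom :=
  pullbackMapHom_hom_snd f₁ f₂ ρ₁.aut a₂ aZ h₁' h₂ g

/-- `ρ(g)` commutes with `p` and with the trivial action on `Q` (compatibility datum for the base-changed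
action). [folklore] -/
private theorem baseChange_compat₁ {X Q : Scheme.{u}} {p : X ⟶ Q} (ρ : ActionOver p G) (g : G) :
    (ρ.aut g).hom ≫ p = p ≫ ((1 : G →* Aut Q) g).hom := by
  rw [MonoidHom.one_apply, ρ.aut_comp]; exact (Category.comp_id _).symm

/-- The trivial actions on `Y′` and `Q` are compatible with any `f : Y′ → Q`. [folklore] -/
private theorem baseChange_compat₂ {Q Y' : Scheme.{u}} (f : Y' ⟶ Q) (g : G) :
    ((1 : G →* Aut Y') g).hom ≫ f = f ≫ ((1 : G →* Aut Q) g).hom := by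
  rw [MonoidHom.one_apply, MonoidHom.one_apply]
  exact (Category.id_comp _).trans (Category.comp_id _).symm

/-- **The base-changed action.** If `G` acts on `X` over `p : X → Q` (`ρ : ActionOver p G`, so each
`ρ(g)` commutes with `p`) and `f : Y′ → Q` is any morphism, then `G` acts on `X ×_Q Y′` over the second
projection by `ρ(g) × id` — the datum `ρ′` of ★ `isGeometricQuotient_baseChange_of_free` /
`…_of_flat` / `…_of_isUnit_card` (SGA 1 V §1 «la formation de `X/G` commute au changement de base
plat»). [cite: SGA1, Exp. V §1, Prop. 1.9] -/
def baseChange {X Q Y' : Scheme.{u}} {p : X ⟶ Q} (ρ : ActionOver p G) (f : Y' ⟶ Q) :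
    ActionOver (pullback.snd p f) G :=
  onPullback p f ρ.aut 1 1 (baseChange_compat₁ ρ) (baseChange_compat₂ f) (pullback.snd p f) fun g => by
    rw [pullbackMapHom_hom_snd, MonoidHom.one_apply]; exact Category.comp_id _

/-- The base-changed action covers `ρ(g)` along `pr₁` — the compatibility hypothesis `hρ′` of the ★
base-change theorems. [cite: SGA1, Exp. V §1, Prop. 1.9] -/
@[simp] theorem baseChange_aut_hom_fst {X Q Y' : Scheme.{u}} {p : X ⟶ Q} (ρ : ActionOver p G)
    (f : Y' ⟶ Q) (g : G) :
    ((ρ.baseChange f).aut g).hom ≫ pullback.fst p f = pullback.fst p f ≫ (ρ.aut g).hom :=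
  pullbackMapHom_hom_fst p f ρ.aut 1 1 (baseChange_compat₁ ρ) (baseChange_compat₂ f) g

/-- The base-changed action is trivial on the second factor: `ρ′(g) ≫ pr₂ = pr₂`.
[cite: SGA1, Exp. V §1, Prop. 1.9] -/
@[simp] theorem baseChange_aut_hom_snd {X Q Y' : Scheme.{u}} {p : X ⟶ Q} (ρ : ActionOver p G)
    (f : Y' ⟶ Q) (g : G) :
    ((ρ.baseChange f).aut g).hom ≫ pullback.snd p f = pullback.snd p f :=
  (ρ.baseChange f).aut_comp g

end Literature.AlgebraicGeometry.RelativeSpec.ActionOver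

end
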